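import Literature.Computability.QuantumComplexity.PeriodFindingEstimates
import Literature.Computability.Cryptography.OrderFindingPostSpec
import HarnessLib

/-!
# Boneh–Lipton period finding read out by Kitaev's Hadamard tests, V: the hit test by continued fractions

Topic `Literature/Computability/QuantumComplexity`; sequel of `PeriodFindingEstimates.lean`. The
hit test `Hit N u` there ("some `q ∈ [⌊√N⌋/4, ⌊√N⌋/2]` has a fraction `p/q` strictly within
`1/2N` of `u/N`") quantifies over exponentially many denominators; the post-processor of the
period-finding family must decide a hit in polynomial time. This file gives the COMPUTABLE form:
run the tree's continued-fraction recovery `OFPostCF.cfCandidate` (Shor 1997, §5: "round `c/q`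
to the nearest fraction having a denominator smaller than `n` … by a continued fraction
expansion"; polynomial time by `OFPostB.cfScanF`, `OrderFindingPostCF.lean`) with denominator
bound `⌊√N⌋` and precision `1/2N`, round `u r/N` to the nearest integer `d`, and test the range
and the strict inequality on `(d, r)`:

* `cfDen`, `rnd`, `hitS b u` (a `Bool`);
* `hit_of_hitS` — a computable hit is a hit (`(rnd, cfDen)` is a witness), so the uniform-sample
  bound `card_filter_hit_le` applies to `hitS`;
* `hitS_of_good` — Shor's good outcomes of an odd `a` in the range, `d` coprime to `a`, pass
  (`OFPostCF.cfCandidate_eq_candidate`, `Shor1997.candidate_div_eq`);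
* `exists_threshold_hitS_mass` — the hitting samples carry mass `≥ (a-1)/3a` under Shor's law
  (as `exists_threshold_hit_mass`, keeping the coprimality of the good fractions).

## References

* P. W. Shor, SIAM J. Comput. 26 (1997), §5 [Shor1997].
* S. Aaronson, L. Chen, CCC 2017, arXiv:1612.05903, App. 13 (p. 42) [AaronsonChen2017].
-/

noncomputable section

namespace Literature.Computability.QuantumComplexity

namespace PeriodFinding

open Finset Literature.Computability.Cryptography Literature.Computability.Cryptography.OFPostCF

/-! ### The computable hit test -/

/-- **The candidate period read off the sample `u`** by continued fractions: the least
denominator `< ⌊√N⌋` of a fraction within `1/2N` of `u/N` (`N = 2^b`; `0` if none), computed as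
`OFPostCF.cfCandidate ⌊√N⌋ N u N (2b + 3)`. [cite: Shor1997, §5 (continued fraction recovery of d/r)] -/
def cfDen (b u : ℕ) : ℕ := cfCandidate (Nat.sqrt (2 ^ b)) (2 ^ b) u (2 ^ b) (2 * b + 3)

/-- The nearest integer to `u r/N`, `r` the candidate period. [folklore] -/
def rnd (b u : ℕ) : ℕ := (2 * u * cfDen b u + 2 ^ b) / (2 * 2 ^ b)

/-- **The computable hit test**: the candidate period lies in the moduli range and its rounded
fraction is STRICTLY within `1/2N` of `u/N`. [cite: AaronsonChen2017, App. 13 (p. 42)] -/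
def hitS (b u : ℕ) : Bool :=
  decide (qLo (2 ^ b) ≤ cfDen b u ∧ cfDen b u ≤ qHi (2 ^ b) ∧
    2 * Int.natAbs ((u : ℤ) * cfDen b u - rnd b u * 2 ^ b) < cfDen b u)

/-- The rounded numerator does not exceed the denominator (`u < N`). [folklore] -/
theorem rnd_le {b u : ℕ} (hu : u < 2 ^ b) : rnd b u ≤ cfDen b u := by
  unfold rnd
  set r := cfDen b u
  set N := 2 ^ b
  have hN : 0 < N := Nat.two_pow_pos b
  rw [← Nat.lt_add_one_iff, Nat.div_lt_iff_lt_mul (by omega)]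
  have : 2 * u * r ≤ 2 * (N - 1) * r := by gcongr; omega
  have h2 : 2 * (N - 1) * r + N < (r + 1) * (2 * N) := by
    zify [hN] at *; nlinarith
  omega

/-- **A computable hit is a hit.** [folklore] -/
theorem hit_of_hitS {b u : ℕ} (hu : u < 2 ^ b) (h : hitS b u = true) : Hit (2 ^ b) u := by
  unfold hitS at h
  rw [decide_eq_true_eq] at h
  obtain ⟨hlo, hhi, hlt⟩ := h
  refine ⟨cfDen b u, mem_Icc.2 ⟨hlo, hhi⟩, rnd b u, mem_range.2 (Nat.lt_succ_of_le (rnd_le hu)), ?_⟩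
  have : (2 * ((u : ℤ) * cfDen b u - rnd b u * 2 ^ b).natAbs : ℤ) < cfDen b u := by exact_mod_cast hlt
  rw [Int.natCast_natAbs] at this
  push_cast at this ⊢
  exact this

/-- The candidate range sits below `⌊√N⌋`. [folklore] -/
theorem qHi_lt_sqrt {N : ℕ} (hN : 4 ≤ N) : qHi N < Nat.sqrt N := by
  have : 2 ≤ Nat.sqrt N := by rw [Nat.le_sqrt]; omega
  unfold qHi; omega

/-- **Shor's good outcomes pass the computable test**: for an odd `a` in the range, `d` coprime to
`a` with `d < a`, and `u` with `2|au - dN| ≤ a`, the candidate is `a`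
(`cfCandidate_eq_candidate`, `Shor1997.candidate_div_eq`), the rounding returns `d`, and the strict
inequality holds because its left side is even. [cite: Shor1997, §5 (counting the good states)] -/
theorem hitS_of_good {b a d u : ℕ} (hb : 2 ≤ b) (hodd : Odd a) (hlo : qLo (2 ^ b) ≤ a) (hhi : a ≤ qHi (2 ^ b))
    (hcop : d.Coprime a) (h : 2 * |(a : ℤ) * u - d * (2 ^ b : ℕ)| ≤ a) : hitS b u = true := by
  set N := 2 ^ b with hN
  have hN4 : 4 ≤ N := by
    calc 4 = 2 ^ 2 := by norm_num
      _ ≤ N := Nat.pow_le_pow_right (by norm_num) hb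
  have hNpos : 0 < N := by omega
  have hapos : 0 < a := hodd.pos
  have han : a < Nat.sqrt N := lt_of_le_of_lt hhi (qHi_lt_sqrt hN4)
  have haN : a < N := lt_of_lt_of_le han (Nat.sqrt_le_self N)
  -- the candidate is `a`
  have hden : cfDen b u = a := by
    unfold cfDen
    rw [← hN, cfCandidate_eq_candidate (s := b + 1) (Nat.sqrt_le' N) hNpos
      (by rw [hN, pow_succ]; omega) (by omega)]
    exact Shor1997.candidate_div_eq (Nat.sqrt_le' N) hapos han hcop h
  -- the rounding returns `d`
  have hbounds : 2 * d * N ≤ 2 * u * a + N ∧ 2 * u * a + N < (d + 1) * (2 * N) := by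
    have h1 := le_abs_self ((a : ℤ) * u - d * (N : ℕ))
    have h2 := neg_abs_le ((a : ℤ) * u - d * (N : ℕ))
    have haN' : (a : ℤ) < N := by exact_mod_cast haN
    constructor
    · zify; nlinarith
    · zify; nlinarith
  have hrnd : rnd b u = d := by
    unfold rnd
    rw [hden, ← hN]
    refine Nat.div_eq_of_lt_le ?_ hbounds.2
    calc d * (2 * N) = 2 * d * N := by ring
      _ ≤ _ := hbounds.1
  -- the strict test
  unfold hitS
  rw [decide_eq_true_eq, hden, hrnd]
  refine ⟨hlo, hhi, ?_⟩
  have key : ((u : ℤ) * (a : ℕ) - ((d : ℕ) : ℤ) * 2 ^ b) = ((a : ℤ) * u - d * (N : ℕ)) := by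
    rw [hN]; push_cast; ring
  rw [key]
  have hle : 2 * ((a : ℤ) * u - d * (N : ℕ)).natAbs ≤ a := by
    have : (2 * ((a : ℤ) * u - d * (N : ℕ)).natAbs : ℤ) ≤ a := by rw [Int.natCast_natAbs]; exact h
    exact_mod_cast this
  rcases hle.lt_or_eq with hlt | heq
  · exact hlt
  · exfalso
    exact (Nat.not_even_iff_odd.2 hodd) ⟨((a : ℤ) * u - d * (N : ℕ)).natAbs, by omega⟩

/-- **The mass of the samples passing the computable test under Shor's distribution.** For every
large `b` and every odd prime `a` in the candidate range of `N = 2^b`, at least `(a-1)/3a`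
(`Shor1997.totient_div_le_sum_outcomeProb` with `n = ⌊√N⌋`; its good outcomes have coprime
fractions `d/a`, `0 < d < a`, and pass by `hitS_of_good`). [cite: Shor1997, §5 (counting the good states)] -/
theorem exists_threshold_hitS_mass :
    ∃ b₀ : ℕ, ∀ b : ℕ, b₀ ≤ b → ∀ a : ℕ, a.Prime → Odd a → qLo (2 ^ b) ≤ a → a ≤ qHi (2 ^ b) →
      ((a : ℝ) - 1) / (3 * a) ≤
        ∑ u ∈ (range (2 ^ b)).filter (fun u => hitS b u = true), ∑ k ∈ range a, Shor1997.outcomeProb (2 ^ b) a k u := by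
  classical
  obtain ⟨n₀, hn₀⟩ := Shor1997.totient_div_le_sum_outcomeProb
  refine ⟨(max n₀ 3) ^ 2, fun b hb a hap hao h1 h2 => ?_⟩
  set N := 2 ^ b with hN
  set n := Nat.sqrt N with hn
  have hbN : b < N := Nat.lt_two_pow_self
  have hb2 : 2 ≤ b := le_trans (by nlinarith [le_max_right n₀ 3]) hb
  have hn3 : max n₀ 3 ≤ n := by
    rw [hn, Nat.le_sqrt]
    calc max n₀ 3 * max n₀ 3 = (max n₀ 3) ^ 2 := (sq _).symm
      _ ≤ N := by omega
  have hnn : n * n ≤ N := Nat.sqrt_le N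
  have hNn : N < (n + 1) * (n + 1) := Nat.lt_succ_sqrt N
  have hq1 : n ^ 2 ≤ N := by rw [sq]; exact hnn
  have hq2 : N < 2 * n ^ 2 := by
    have h3 : 3 ≤ n := le_trans (le_max_right _ _) hn3
    nlinarith
  have hapos : 0 < a := hap.pos
  have han : a < n := by
    have : a ≤ n / 2 := h2
    have h3 : 3 ≤ n := le_trans (le_max_right _ _) hn3
    omega
  have key := hn₀ n N a (le_trans (le_max_left _ _) hn3) hq1 hq2 ⟨b, rfl⟩ hapos han
  rw [Nat.totient_prime hap] at key
  push_cast [hap.one_le] at key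
  refine key.trans ?_
  rw [sum_comm]
  refine sum_le_sum_of_subset_of_nonneg (fun c hc => ?_) fun c _ _ => sum_nonneg fun k _ => ?_
  · rw [mem_filter] at hc ⊢
    obtain ⟨hcN, d, hda, hcop, hd⟩ := hc
    exact ⟨hcN, hitS_of_good hb2 hao h1 h2 hcop hd⟩
  · unfold Shor1997.outcomeProb; positivity

end PeriodFinding

end Literature.Computability.QuantumComplexity

end
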